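import Summits.BirchSwinnertonDyer.BirchSwinnertonDyer.Theorems.KatoDescentPotSupersingularKatoSelmerPTCokernel
import Summits.BirchSwinnertonDyer.Rank1Residual.X11b.RouteR1Coinvariants
import Summits.BirchSwinnertonDyer.Rank1Residual.X11b.PropagatedLocalConditions
import HarnessLib

/-!
# The Poitou–Tate COKERNEL bound for Kato's `S(E[p^∞])`, III: turnkey form
# `∃ s K₀, ∀ K ≥ K₀: #Sel_{p^∞}(E/ℚ) · ∏_{ℓ ∈ T∖{p}} #H¹_ur(ℚ_ℓ, E[p^∞]) ≤ #S · [E(ℚ) : p^K E(ℚ)]`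
# (route `KatoDescentPotSupersingular` / `…Tame…`, crux M = stmt-BirchSwinnertonDyer-19196; route-free helper)

Seat `bsd-potss-rkm` g19 (prover; cell `bsd-potss`), item stmt-BirchSwinnertonDyer-19196 (`--supports … --as helper`; closes nothing).
HONEST FRAMING: BSD is not proved by any of this; nothing is booked; theorems only (no definition, no named fact).

## What

Parts 44a/44b (`…KatoSelmerPTOrthogonal`, `…KatoSelmerPTCokernel`) prove the cokernel bound (ii) for given levels `p^s`, `p^K`, an auxiliary
relaxed Selmer structure `𝓖′` at level `p^s p^K` described by four equations, and the two exponent hypotheses `hs` (`p^s` kills the relevant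
part of `Ш`) and `hK` (`p^K · H¹_ur(ℚ_ℓ, E[p^∞]) = 0`, `ℓ ∈ T∖p`).  Here these are discharged:

* `exists_relaxedSelmerStructure` — the structure `𝓖′` exists (Kummer at `p` and off `T`, `ι′⁻¹ H¹_ur(ℚ_ℓ, E[p^∞])` at `ℓ ∈ T∖p`; a definition by cases,
  stated as an existence theorem so that no `def` enters this file), with `𝓚 ≤ 𝓖′` because `𝓚_ℓ ≤ ker ι′_*` at `ℓ ∤ p` (part 42);
* **`exists_forall_natCard_selmerGroupPInfty_mul_prod_unramified_le`** — for `p` odd, `T ∋ v_p` off which `W` is good, `Sel_{p^∞}(E/ℚ)` finite and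
  `Ш(E/ℚ)[p^∞]` finite: `∃ s K₀, ∀ K ≥ K₀`, for every level-`p^s p^K` Weil datum (alternating, non-degenerate) and every family of local invariants
  at level `p^s p^K` with `IsPerfect` and `SelmerComplement` (Tate local duality / Poitou–Tate, the tree's finite-level predicates):
  `#Sel_{p^∞}(E/ℚ) · ∏_{ℓ ∈ T∖{p}} #H¹_ur(ℚ_ℓ, E[p^∞]) ≤ #S · [E(ℚ) : p^K E(ℚ)]` (`s` = a uniform exponent of `Ш[p^∞]`, X11b
  `exists_pow_nsmul_eq_zero_of_finite_primaryComponent`; `K₀` = one plus the sum of the exponents of the finite `p`-primary groups `H¹(ℚ_ℓ, E[p^∞])`, `ℓ ∈ T∖p`).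

References: K. Kato, Astérisque 295 (2004), §14.8 (p. 238), proof of Prop. 14.16 (pp. 244–245) [Kato2004Asterisque]; J. S. Milne, *ADT* I Thm. 4.10 (b),
Cor. 2.3, Lemma 3.3 [MilneADT2006]; R. Greenberg, LNM 1716 (1999) §§2, 5 [GreenbergLNM1716].
-/

-- the summit and its single problem are both named `BirchSwinnertonDyer` (registry layout D-0017)
set_option linter.dupNamespace false
set_option autoImplicit false

noncomputable section

open scoped Classical ContRepresentation NumberField
open CategoryTheory Function Field NumberField IsDedekindDomain WeierstrassCurve
open Literature.NumberTheory.EllipticCurves Literature.NumberTheory.GaloisRepresentations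
  Literature.NumberTheory.GaloisRepresentations.DiscreteGaloisModule Literature.NumberTheory.GaloisCohomology
open Literature.NumberTheory.EllipticCurves.Kato2004
open Summit.BirchSwinnertonDyer.Rank1Residual.X11b.Levels Summit.BirchSwinnertonDyer.Rank1Residual.X11b.LocBridge
  Summit.BirchSwinnertonDyer.Rank1Residual.X11b.LevelKummer
open Summit.BirchSwinnertonDyer.Rank1Residual.GaloisImage
open Summit.BirchSwinnertonDyer.BirchSwinnertonDyer.Theorems.KummerTowerOrthogonal

universe u

namespace Summit.BirchSwinnertonDyer.BirchSwinnertonDyer.Theorems.KatoFiniteLevelCount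

section Turnkey

variable (W : WeierstrassCurve ℚ) [W.IsElliptic] (p s k : ℕ) [Fact p.Prime]
  (T : Finset (HeightOneSpectrum (𝓞 ℚ)))

/-! ## §1 The relaxed structure `𝓖′` at level `p^s p^K` exists -/

/-- **The relaxed Selmer structure `𝓖′` on `E[p^s p^K]`** — Kummer at `v_p`, at the infinite places and at every place off `T`; `ι′⁻¹ H¹_ur(ℚ_ℓ, E[p^∞])`
at `ℓ ∈ T∖{p}` — exists, contains the Kummer structure (`𝓚_ℓ ≤ ker ι′_*` at `ℓ ∤ p`, part 42), and is unramified off `T` (X11b: Kummer = unramified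
at a good `ℓ ∤ p`).  [cite: GreenbergLNM1716, §5 proof of Prop. 5.8] [cite: JetchevSkinnerWan2017, §2.2.3 (arXiv:1512.06894 p. 7)] -/
theorem exists_relaxedSelmerStructure (hpT : primePlace p ∈ T)
    (hT : ∀ v : HeightOneSpectrum (𝓞 ℚ), v ∉ T → W.HasGoodReductionAt v) :
    ∃ 𝓖' : SelmerStructure (W.torsionGaloisModule ((p ^ s * p ^ k : ℕ) : ℤ)),
      W.kummerSelmerStructure ((p ^ s * p ^ k : ℕ) : ℤ) ≤ 𝓖' ∧
      (∀ v : HeightOneSpectrum (𝓞 ℚ), v ∉ T →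
        𝓖' (Sum.inr v) = unramifiedSubgroup (GaloisRep.toLocal v (W.torsionGaloisModule ((p ^ s * p ^ k : ℕ) : ℤ))) 1) ∧
      (∀ v ∈ T, v ≠ primePlace p →
        𝓖' (Sum.inr v) = (unramifiedSubgroup (GaloisRep.toLocal v (primaryGaloisModule W p)) 1).comap
          (galoisCohomology.map (((primaryInclusion W p (s + k)).comp
            (W.torsionInclusion (natCast_pow_mul_pow_dvd_natCast_pow_add p s k))).restrictField (v.adicCompletion ℚ)) 1)) ∧
      𝓖' (Sum.inr (primePlace p)) = W.kummerSelmerStructure ((p ^ s * p ^ k : ℕ) : ℤ) (Sum.inr (primePlace p)) := by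
  classical
  refine ⟨fun v => @Sum.rec (InfinitePlace ℚ) (HeightOneSpectrum (𝓞 ℚ))
      (fun v => AddSubgroup (galoisCohomology ((W.torsionGaloisModule ((p ^ s * p ^ k : ℕ) : ℤ)).toLocal v) 1))
      (fun w => W.kummerSelmerStructure ((p ^ s * p ^ k : ℕ) : ℤ) (Sum.inl w))
      (fun v => if v ∈ T ∧ v ≠ primePlace p then
          (unramifiedSubgroup (GaloisRep.toLocal v (primaryGaloisModule W p)) 1).comap
            (galoisCohomology.map (((primaryInclusion W p (s + k)).comp
              (W.torsionInclusion (natCast_pow_mul_pow_dvd_natCast_pow_add p s k))).restrictField (v.adicCompletion ℚ)) 1)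
        else W.kummerSelmerStructure ((p ^ s * p ^ k : ℕ) : ℤ) (Sum.inr v)) v, ?_, ?_, ?_, ?_⟩
  · intro v
    rcases v with w | v
    · exact le_rfl
    · dsimp only []
      split_ifs with hv
      · intro z hz
        have hpv : ((p : ℕ) : 𝓞 ℚ) ∉ v.asIdeal := natCast_not_mem_of_ne_primePlace p hv.2
        have h0 := (AddMonoidHom.mem_ker).1 (kummerLocalConditionAt_le_ker_map_iotaPrime W p s k v hpv hz)
        exact AddSubgroup.mem_comap.2
          ((congrArg (fun y => y ∈ unramifiedSubgroup (GaloisRep.toLocal v (primaryGaloisModule W p)) 1) h0).mpr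
            (zero_mem _))
      · exact le_rfl
  · intro v hvT
    dsimp only []
    rw [if_neg (fun h => hvT h.1)]
    exact kummerSelmerStructure_inr_eq_unramifiedSubgroup_pow_mul_pow W p s k
      (natCast_not_mem_of_ne_primePlace p (fun h => hvT (h ▸ hpT))) (hT v hvT)
  · intro v hvT hvp
    dsimp only []
    rw [if_pos ⟨hvT, hvp⟩]
    rfl
  · dsimp only []
    rw [if_neg (fun h => h.2 rfl)]

/-! ## §2 The turnkey cokernel bound -/

/-- **THE COKERNEL BOUND (ii), TURNKEY: `∃ s K₀, ∀ K ≥ K₀: #Sel_{p^∞}(E/ℚ) · ∏_{ℓ ∈ T∖{p}} #H¹_ur(ℚ_ℓ, E[p^∞]) ≤ #S · [E(ℚ) : p^K E(ℚ)]`** for every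
level-`p^s p^K` Weil datum (alternating, non-degenerate) and every family of local invariants at level `p^s p^K` satisfying Tate local duality
(`IsPerfect`) and Poitou–Tate (`SelmerComplement`) — `p` odd, `T ∋ v_p` off which `W` is good, `Sel_{p^∞}(E/ℚ)` and `Ш(E/ℚ)[p^∞]` finite, `S` Kato's
`H¹_{𝓤∞} ⊓ selmerLocalKerPrimary W ℚ_p p`.  In rank `0` and `K ≫ 0` the right-hand factor is `#E(ℚ)[p^∞] = p^{t₀}` and `#H¹_ur(ℚ_ℓ,E[p^∞]) = p^{v_p(c_ℓ)}`
(g18), so this is `#Ш[p^∞] · ∏_{ℓ≠p} c_ℓ^{(p)} ≤ #S · p^{t₀}` — the converse of part 38 and the direction crux M consumes.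
[cite: Kato2004Asterisque, §14.8 (p. 238) and proof of Prop. 14.16 (pp. 244–245)] [cite: MilneADT2006, Ch. I, Thm. 4.10 (b), Cor. 2.3, Lemma 3.3]
[cite: GreenbergLNM1716, §2 and §5 proof of Prop. 5.8] -/
theorem exists_forall_natCard_selmerGroupPInfty_mul_prod_unramified_le (hodd : p ≠ 2)
    (hpT : primePlace p ∈ T) (hT : ∀ v : HeightOneSpectrum (𝓞 ℚ), v ∉ T → W.HasGoodReductionAt v)
    [Finite (W.selmerGroupPInfty p)] [Finite (AddCommGroup.primaryComponent (↥W.sha) p)]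
    (𝓤inf : SelmerStructure (primaryGaloisModule W p))
    (hUp : 𝓤inf (Sum.inr (primePlace p)) = ⊤)
    (hUur : ∀ v : HeightOneSpectrum (𝓞 ℚ), v ≠ primePlace p →
      𝓤inf (Sum.inr v) = unramifiedSubgroup (GaloisRep.toLocal v (primaryGaloisModule W p)) 1)
    (hUinl : ∀ w : InfinitePlace ℚ, 𝓤inf (Sum.inl w) = ⊤) :
    ∃ s K₀ : ℕ, ∀ k : ℕ, K₀ ≤ k →
      haveI := neZero_pow p s; haveI := neZero_pow p k
      haveI : Finite (geomTorsion W ((p ^ s * p ^ k : ℕ) : ℤ)) :=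
        W.finite_torsionPoints_holds (AlgebraicClosure ℚ) (Int.natCast_ne_zero.mpr (NeZero.ne (p ^ s * p ^ k)))
      haveI : Finite (geomTorsion W ((p ^ k : ℕ) : ℤ)) := Rank1Residual.X11b.AcSelmer.finite_geomTorsion_pow W p k
      ∀ (e : geomTorsion W ((p ^ s * p ^ k : ℕ) : ℤ) → geomTorsion W ((p ^ s * p ^ k : ℕ) : ℤ) → AlgebraicClosure ℚ)
        (hμ : ∀ S T, e S T ^ (p ^ s * p ^ k) = 1)
        (hadd₁ : ∀ S₁ S₂ T, e (S₁ + S₂) T = e S₁ T * e S₂ T)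
        (hadd₂ : ∀ S T₁ T₂, e S (T₁ + T₂) = e S T₁ * e S T₂)
        (hgal : ∀ (σ : absoluteGaloisGroup ℚ) (S T : geomTorsion W ((p ^ s * p ^ k : ℕ) : ℤ)), σ • e S T = e (σ • S) (σ • T)),
        (∀ P, e P P = 1) → (∀ P, (∀ Q, e Q P = 1) → P = 0) →
      ∀ (inv : LocalInvariants ℚ (p ^ s * p ^ k)), inv.IsPerfect → inv.SelmerComplement →
      Nat.card (W.selmerGroupPInfty p) *
          ∏ v ∈ T \ {primePlace p}, Nat.card (unramifiedSubgroup (GaloisRep.toLocal v (primaryGaloisModule W p)) 1) ≤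
        Nat.card ↥(𝓤inf.selmerGroup ⊓ selmerLocalKerPrimary W ((primePlace p).adicCompletion ℚ) p) *
          (zsmulAddGroupHom ((p ^ k : ℕ) : ℤ) : W.toAffine.Point →+ W.toAffine.Point).range.index := by
  have hp : p.Prime := Fact.out
  -- a uniform exponent of `Ш[p^∞]`
  obtain ⟨s, hs⟩ := Rank1Residual.X11b.exists_pow_nsmul_eq_zero_of_finite_primaryComponent (A := ↥W.sha) p
  -- uniform exponents of the finite `p`-primary groups `H¹(ℚ_ℓ, E[p^∞])`, `ℓ ∈ T ∖ p`
  have hB : ∀ Q : W.geomPrimaryTorsion p, ∃ j : ℕ, p ^ j • Q = 0 := fun Q =>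
    (AddCommGroup.mem_primaryComponent.mp Q.2).imp fun j hj =>
      Subtype.ext (by rw [AddSubmonoidClass.coe_nsmul, hj, ZeroMemClass.coe_zero])
  have hK' : ∀ ℓ : ↥(T \ {primePlace p}), ∃ m : ℕ,
      ∀ u : galoisCohomology (GaloisRep.toLocal ℓ.1 (primaryGaloisModule W p)) 1, p ^ m • u = 0 := fun ℓ => by
    have hpℓ : ((p : ℕ) : 𝓞 ℚ) ∉ ℓ.1.asIdeal :=
      natCast_not_mem_of_ne_primePlace p (fun h' => (Finset.mem_sdiff.1 ℓ.2).2 (Finset.mem_singleton.2 h'))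
    haveI : CharZero (ℓ.1.adicCompletion ℚ) := charZero_adicCompletion _
    haveI : Finite (galoisCohomology (GaloisRep.toLocal ℓ.1 (primaryGaloisModule W p)) 1) :=
      finite_galoisCohomology_one_primary_toLocal W p ℓ.1 (localEulerPoincareCharacteristic_holds _) hpℓ
    obtain ⟨m, hm⟩ := Rank1Residual.X11b.exists_pow_nsmul_eq_zero_of_finite_primaryComponent
      (A := galoisCohomology (GaloisRep.toLocal ℓ.1 (primaryGaloisModule W p)) 1) p
    refine ⟨m, fun u => ?_⟩
    obtain ⟨j, hj⟩ := exists_pow_nsmul_eq_zero_of_primary (GaloisRep.toLocal ℓ.1 (primaryGaloisModule W p)) hB u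
    exact hm j u hj
  choose m hm using hK'
  refine ⟨s, Finset.univ.sum m + 1, fun k hk => ?_⟩
  haveI := neZero_pow p s; haveI := neZero_pow p k
  haveI : Finite (geomTorsion W ((p ^ s * p ^ k : ℕ) : ℤ)) :=
    W.finite_torsionPoints_holds (AlgebraicClosure ℚ) (Int.natCast_ne_zero.mpr (NeZero.ne (p ^ s * p ^ k)))
  haveI : Finite (geomTorsion W ((p ^ k : ℕ) : ℤ)) := Rank1Residual.X11b.AcSelmer.finite_geomTorsion_pow W p k
  intro e hμ hadd₁ hadd₂ hgal halt hnondeg inv hperf hcompl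
  obtain ⟨𝓖', hle, hgood, hT', hp'⟩ := exists_relaxedSelmerStructure W p s k T hpT hT
  refine natCard_selmerGroupPInfty_mul_prod_unramified_le_index W p s k T e hμ hadd₁ hadd₂ hgal inv hodd
    ((Nat.le_add_left 1 _).trans hk) halt hnondeg hperf hcompl hpT hT 𝓤inf hUp hUur hUinl 𝓖' hle hgood hT' hp' ?_ ?_
  · -- `hs`: `p^s` kills the `p^s p^k`-torsion of `Ш`
    intro a ha h
    rw [natCast_zsmul, ← pow_add] at h
    have hQ : p ^ (s + k) • (⟨a, ha⟩ : ↥W.sha) = 0 := Subtype.ext h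
    exact congrArg Subtype.val (hs (s + k) ⟨a, ha⟩ hQ)
  · -- `hK`: `p^k` kills `H¹_ur(ℚ_ℓ, E[p^∞])`, `ℓ ∈ T ∖ p`
    intro v hv u _
    have hle' : m ⟨v, hv⟩ ≤ k :=
      ((Finset.single_le_sum (fun _ _ => Nat.zero_le _) (Finset.mem_univ _)).trans (Nat.le_succ _)).trans hk
    rw [← Nat.sub_add_cancel hle', pow_add, mul_smul, hm ⟨v, hv⟩ u, smul_zero]

end Turnkey

end Summit.BirchSwinnertonDyer.BirchSwinnertonDyer.Theorems.KatoFiniteLevelCount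

end
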